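import Mathlib.Algebra.BigOperators.Ring.Finset
import Mathlib.Algebra.Order.BigOperators.Group.Finset
import Mathlib.Algebra.Order.BigOperators.Ring.Finset
import Mathlib.Data.Fintype.BigOperators
import Mathlib.Data.Fintype.Pi
import Mathlib.Algebra.Order.Archimedean.Real.Basic
import Mathlib.Order.ConditionallyCompleteLattice.Indexed
import Mathlib.Tactic.Linarith
import Mathlib.Tactic.Positivity
import HarnessLib

/-!
# Many secret tests answered at once: the product of the cell bounds

Trunk T-CPLX-CORE, generic finite probability as `Finset` sums. App. D campaign (design v3),
generic lemma G1, of the discharge of `Literature.Barriers.PneNP.AkaviaEtAl2006_complMemIPk`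
(Akavia–Goldreich–Goldwasser–Moshkovitz, STOC 2006, App. D), but independent of it.

**The situation.** A verifier runs many tests in parallel, one per position `j : ι`. The coins of
position `j` are `θ j`, uniform on a finite set `D j` and independent across positions. The prover
is shown only a CHALLENGE `ch j (θ j)` of each position, but all of them at once, and then answers
every position with a response that may depend on the whole challenge vector (`resp j c⃗`); position
`j` passes iff `ok j (θ j) response`. For a single test the right soundness quantity is the **cell
bound**: for each challenge value `c`, the best total weight `bestCell` a response can collect from
the cell `{θ ∈ D j | ch j θ = c}` (the secret is uniform on its cell given the view), summed over
`c`. The lemma `sum_piFinset_pass_le` says that against an adaptive prover answering all positions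
jointly, the weight of "every position passes" is at most the PRODUCT of the per-position sums of
cell bounds — adaptivity across independent tests buys nothing, because on each challenge vector the
passing coin tuples form a product of per-position cells. (This is the step "given the view, the
secrets are independent, each uniform on its bucket" of the soundness of the Aiello–Håstad
upper-bound protocol when many instances are run in parallel, AGGM App. B.2 / App. D; with the
indicator weight and a one-point `ok` it is also the union-free form of "the prover's replies cannot
create hits" for public-coin tests.) Weights `wt j θ ≥ 0` (rather than plain counts) allow
exponential-moment arguments ("more than `u` planted positions cheat") downstream.

Contents: `bestCell`, `sum_filter_le_bestCell`, `bestCell_nonneg`, `sum_piFinset_pass_le`.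
Mathlib only, all proved, [folklore].

## References

* A. Akavia, O. Goldreich, S. Goldwasser, D. Moshkovitz, *On basing one-way functions on
  NP-hardness*, STOC 2006 (held preprint), App. B.2.1 (Thm. 6: the secret is uniform on its hash
  bucket given the prover's view), App. D (many samples tested at once).
* W. Aiello, J. Håstad, *Statistical zero-knowledge languages can be recognized in two rounds*,
  JCSS 42 (1991), §4.
-/

noncomputable section

namespace Literature.Computability.Complexity

namespace AdaptiveCells

open Finset

open scoped Classical

variable {ι Θ Ch R : Type*}

/-- **The cell bound** of one test at the challenge value `c`: the largest total weight of coins in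
the cell `{θ ∈ D | ch θ = c}` that a single response passes. [folklore] -/
def bestCell [DecidableEq Ch] (D : Finset Θ) (ch : Θ → Ch) (ok : Θ → R → Prop) (wt : Θ → ℝ)
    (c : Ch) : ℝ :=
  ⨆ r : R, ∑ θ ∈ D.filter (fun θ => ch θ = c ∧ ok θ r), wt θ

/-- Every response collects at most the cell bound. [folklore] -/
theorem sum_filter_le_bestCell [DecidableEq Ch] (D : Finset Θ) (ch : Θ → Ch) (ok : Θ → R → Prop)
    {wt : Θ → ℝ} (hwt : ∀ θ, 0 ≤ wt θ) (c : Ch) (r : R) :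
    ∑ θ ∈ D.filter (fun θ => ch θ = c ∧ ok θ r), wt θ ≤ bestCell D ch ok wt c := by
  classical
  refine le_ciSup (f := fun r : R => ∑ θ ∈ D.filter (fun θ => ch θ = c ∧ ok θ r), wt θ) ?_ r
  refine ⟨∑ θ ∈ D, wt θ, ?_⟩
  rintro x ⟨r', rfl⟩
  exact sum_le_sum_of_subset_of_nonneg (filter_subset _ _) fun θ _ _ => hwt θ

/-- The cell bound is nonnegative (responses exist). [folklore] -/
theorem bestCell_nonneg [DecidableEq Ch] [Nonempty R] (D : Finset Θ) (ch : Θ → Ch)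
    (ok : Θ → R → Prop) {wt : Θ → ℝ} (hwt : ∀ θ, 0 ≤ wt θ) (c : Ch) : 0 ≤ bestCell D ch ok wt c :=
  le_trans (sum_nonneg fun θ _ => hwt θ)
    (sum_filter_le_bestCell D ch ok hwt c (Classical.arbitrary R))

/-- **Adaptive provers gain nothing across independent tests.** For coin tuples `θ ∈ Π_j D j`,
challenges `ch j (θ j)` shown jointly, and responses `resp j` depending on the whole challenge
vector, the total weight of the tuples on which EVERY position passes is at most
`∏_j Σ_c bestCell_j(c)`, hence at most `∏_j bnd j` for any per-position bounds on these sums.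
[folklore] -/
theorem sum_piFinset_pass_le [Fintype ι] [DecidableEq ι] [DecidableEq Θ] [Fintype Ch] [DecidableEq Ch]
    [Nonempty R] (D : ι → Finset Θ) (ch : ι → Θ → Ch) (ok : ι → Θ → R → Prop) (wt : ι → Θ → ℝ)
    (hwt : ∀ j θ, 0 ≤ wt j θ) (bnd : ι → ℝ)
    (hbnd : ∀ j, ∑ c, bestCell (D j) (ch j) (ok j) (wt j) c ≤ bnd j) (resp : ι → (ι → Ch) → R) :
    ∑ θ ∈ Fintype.piFinset D,
        (if ∀ j, ok j (θ j) (resp j fun i => ch i (θ i)) then ∏ j, wt j (θ j) else 0) ≤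
      ∏ j, bnd j := by
  classical
  -- group the coin tuples by their challenge vector
  rw [← sum_fiberwise (Fintype.piFinset D) (fun θ : ι → Θ => fun i => ch i (θ i))
    (fun θ => if ∀ j, ok j (θ j) (resp j fun i => ch i (θ i)) then ∏ j, wt j (θ j) else 0)]
  -- on the fibre of `cv`, the passing tuples form the product of the cells
  have hfib : ∀ cv : ι → Ch,
      ∑ θ ∈ (Fintype.piFinset D).filter (fun θ => (fun i => ch i (θ i)) = cv),
        (if ∀ j, ok j (θ j) (resp j fun i => ch i (θ i)) then ∏ j, wt j (θ j) else 0) =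
        ∏ j, ∑ θ ∈ (D j).filter (fun θ => ch j θ = cv j ∧ ok j θ (resp j cv)), wt j θ := by
    intro cv
    rw [Finset.prod_univ_sum]
    -- both sides are sums over the same finset of tuples, of the same products
    rw [← sum_filter_add_sum_filter_not _ (fun θ : ι → Θ => ∀ j, ok j (θ j) (resp j cv))]
    have hzero : ∑ θ ∈ ((Fintype.piFinset D).filter (fun θ => (fun i => ch i (θ i)) = cv)).filter
        (fun θ : ι → Θ => ¬ ∀ j, ok j (θ j) (resp j cv)),
        (if ∀ j, ok j (θ j) (resp j fun i => ch i (θ i)) then ∏ j, wt j (θ j) else 0) = 0 := by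
      refine sum_eq_zero fun θ hθ => ?_
      rw [mem_filter, mem_filter] at hθ
      obtain ⟨⟨-, hcv⟩, hnot⟩ := hθ
      rw [hcv, if_neg hnot]
    rw [hzero, add_zero]
    have hset : ((Fintype.piFinset D).filter (fun θ => (fun i => ch i (θ i)) = cv)).filter
        (fun θ : ι → Θ => ∀ j, ok j (θ j) (resp j cv)) =
        Fintype.piFinset fun j => (D j).filter (fun θ => ch j θ = cv j ∧ ok j θ (resp j cv)) := by
      ext θ
      simp only [mem_filter, Fintype.mem_piFinset, funext_iff]
      constructor
      · rintro ⟨⟨hD, hcv⟩, hok⟩ j; exact ⟨hD j, hcv j, hok j⟩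
      · intro h; exact ⟨⟨fun j => (h j).1, fun j => (h j).2.1⟩, fun j => (h j).2.2⟩
    rw [hset]
    refine sum_congr rfl fun θ hθ => ?_
    rw [Fintype.mem_piFinset] at hθ
    have hcv : (fun i => ch i (θ i)) = cv := funext fun i => (mem_filter.1 (hθ i)).2.1
    rw [hcv, if_pos fun j => (mem_filter.1 (hθ j)).2.2]
  rw [sum_congr rfl fun cv _ => hfib cv]
  -- bound each cell by the cell bound, then un-distribute
  calc ∑ cv : ι → Ch, ∏ j, ∑ θ ∈ (D j).filter (fun θ => ch j θ = cv j ∧ ok j θ (resp j cv)), wt j θ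
      ≤ ∑ cv : ι → Ch, ∏ j, bestCell (D j) (ch j) (ok j) (wt j) (cv j) :=
        sum_le_sum fun cv _ => prod_le_prod (fun j _ => sum_nonneg fun θ _ => hwt j θ)
          fun j _ => sum_filter_le_bestCell (D j) (ch j) (ok j) (hwt j) (cv j) (resp j cv)
    _ = ∏ j, ∑ c, bestCell (D j) (ch j) (ok j) (wt j) c := by
        rw [Finset.prod_univ_sum (fun _ => (univ : Finset Ch)), Fintype.piFinset_univ]
    _ ≤ ∏ j, bnd j :=
        prod_le_prod (fun j _ => sum_nonneg fun c _ => bestCell_nonneg (D j) (ch j) (ok j) (hwt j) c)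
          fun j _ => hbnd j

end AdaptiveCells

end Literature.Computability.Complexity

end
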